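import Summits.Ventures.YMGap.YM3IR.BalabanSUN
import Summits.Ventures.YMGap.RobustBall.StarRowsSU3PV2TDim3
import HarnessLib

/-!
# YM3IR / BalabanCeilingsSU3PV2T — the §Y4 sentence for `SU(3)` on engine-2's HYPOTHESIS-FREE PV2T-star rows (TWISTED one-link
Poincaré constant; Wilson `β_W = 5/8`, `3/5`, `11/20`, and the FAT rows `13/25`, `1/2`), with the counted crossovers (theorems only;
no new conjecture name)

HONEST FRAMING (cell pub-ymgap, track Y4 / YM3-IR, seat ym3ir-theory-1, gen 72 (staged); follow-up to `YM3IR/BalabanCeilingsSU3PV2.lean`,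
written once engine-2 (g11)'s `RobustBall/StarRowsSU3PV2TDim3.lean` (the `d = 3` cells of ds-2's robust vertex-star doors in variance
form fed with engine-2's TWISTED Poincaré constant `OneLinkModulusSU3Twisted.su3_pv2t_star_inputs` × the CENTRED Schwinger–Dyson
variance, HYPOTHESIS-FREE for `SU(3)`) is in the tree WITH COMMIT (`29dd74e5950b`), per R212 (iii)).  This file claims NO summit, NO
mass gap and NO part of Bałaban's theorems.  It is kernel-checked BOOKKEEPING: `BalabanSUN.massGap3Cofinal_suN_balaban_of_irConjecture3`
at `N = 3` with track Y2's input (`ClusterDomainClustering`) DISCHARGED BY NAME by engine-2's hypothesis-free `SU(3)` PV2T-star rows: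
`RobustBall.su3_clusterDomainClustering_dim3_pv2tStar_fiveEighths r` (tree ceiling `5/24` = Wilson `5/8`, ball
`ClusterDomainFR (1/250) (1/500) r` — the highest hypothesis-free `SU(3)` `d = 3` ceiling in the tree; radius a door artefact),
`…_threeFifths r` (tree `1/5` = Wilson `3/5`, ball `ClusterDomainFR (1/25) (1/50) r` — the ball of engine-2's `ℤ³` SEGMENT
`su3_massGapOnBallZdG_dim3_pv2tStar_upTo_threeFifths`), `…_elevenTwentieths r` (tree `11/60` = Wilson `11/20`, ball
`ClusterDomainFR (57/500) (57/1000) r`), and the two FAT rows at the ceilings of `BalabanCeilingsSU3PV2`: `…_thirteenTwentyFifths r`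
(tree `13/75` = Wilson `13/25`, ball `ClusterDomainFR (39/250) (39/500) r ⊋ (3/125, 3/250)` of the PV2 row) and `…_oneHalf r` (tree
`1/6` = Wilson `1/2`, ball `ClusterDomainFR (23/125) (23/250) r ⊋ (3/50, 3/100)`) — at the same ceiling a larger receiving ball is a
WEAKER hypothesis (a) (`YM3IR/BallMonotone.lean`: `irConjecture3_mono`, `inBall_ballOfRobustBallFR_mono`), hence a STRONGER sentence.
WHAT MOVES on the UV side: the hypothesis-free `SU(3)` tier-1 receiving end of the §Y4 sentence rises from Wilson `13/25`
(`BalabanCeilingsSU3PV2`) to `5/8`, and the `13/25` / `1/2` sentences are re-booked on the fat PV2T balls; the CERTIFIED rows GIVEN H1, H2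
(`BalabanCeilingsSU3Certified`, Wilson `33/40`) are untouched and remain higher.  Rows with a higher ceiling bought with smaller radii are
INCOMPARABLE sentences (`BallMonotone` header), so the `5/8`, `3/5`, `11/20` rows do not supersede the fat `13/25` row.  Lattice
statements only; strong-coupling constants; no continuum limit, no Millennium claim; no axiom, no `sorry`, no `def`; `0` compute.

THE HYPOTHESIS LIST, VERBATIM (`massGap3Cofinal_su3_balaban_pv2tStar_fiveEighths_of_irConjecture3`): `BalabanUV3 mk` — IN PRINT
(Bałaban, CMP 102 (1985), Thm 1 p. 257 + Thm 2 p. 272), EVIDENTIAL (theory-2 F2: the kernel arrow does not consume it);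
`Nonempty (Family L eps0)` — print's clauses at one coupling (p. 256 L15–18); `0 < C_b`, `0 < κ`;
`IRConjecture3 (ballOfRobustBallFR 3 (1/250) (1/500) r (5/24)) suFrobDist (fundamentalRep (Fin 3)) (balabanCouplings L (suGroupModel 3)
eps0) C_b κ` — the ONE CONJECTURE of record (theory-2, `YM3IR/Statement.lean`; NOT in print).  LABEL OF RECORD (R196, verbatim): with
existential `(C_b, κ)` this is a typed INTERFACE, a «dictionary, not a reduction» (forest witness, `YM3IR/ForestWitnessSUN.lean`).
CONCLUSION: `MassGap3Cofinal (balabanCouplings L (suGroupModel 3) eps0) suFrobDist (fundamentalRep (Fin 3))`.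

COUNTED CROSSOVERS (PROVED arithmetic, tree units `β = β_W/3`): below the ceiling `5/24` after `K + M'` steps iff `L^{M'} ≥ 8/(5γ₀²)`
(`su3_betaTree_div_pow_le_5_24_iff`; `≥ 8/5` with `γ₀² ≤ 1`), below `1/5` iff `L^{M'} ≥ 5/(3γ₀²)` (`su3_betaTree_div_pow_le_fifth_iff`),
below `11/60` iff `L^{M'} ≥ 20/(11γ₀²)` (`su3_betaTree_div_pow_le_11_60_iff`) — vs `25/(13γ₀²)` at `13/75` and `2/γ₀²` at `1/6`
(`BalabanCeilingsSU3PV2.su3_betaTree_div_pow_le_13_75_iff` / `…_sixth_iff`, NOT restated here — the gate's dedup rule).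

WHY THIS IS USEFUL (one sentence).  The `SU(3)` — physical colour group — instance of «print + certified strong-coupling expansion + ONE
named conjecture ⟹ lattice YM₃ mass gap on Bałaban's coupling set» with Y2's input a HYPOTHESIS-FREE theorem up to Wilson `β_W = 5/8`
and its explicit crossover count `L^{M'} ≥ 8/(5γ₀²)`.

References: T. Bałaban, CMP 102 (1985) 255–275, p. 256 L15–18, (5) p. 256, Thm 1 p. 257, Thm 2 p. 272 [cite: Balaban1985UV3];
D. Bakry, M. Émery (1985) and H. Shen, R. Zhu, X. Zhu, CMP 400 (2023) Lemma 4.1 (the one-link Poincaré / vertex σ-model dictionary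
behind the star rows; engine-2's file headers `Thresholds/TwistedBochnerSU3.lean`, `RobustBall/StarRowsSU3PV2TDim3.lean`).
-/

noncomputable section

open MeasureTheory
open Literature.MathematicalPhysics.QuantumLattice Literature.MathematicalPhysics.QuantumFieldTheory
open Balaban1985CMP102 Balaban1985CMP102.Setting Balaban1985CMP102.Theorems
open Literature.MathematicalPhysics.QuantumFieldTheory.Balaban1983to89 (GaugeGroup HaarData)
open Summit.QuantumFields.Balaban3D.Carriers (suGroupModel)

namespace Summit.Ventures.YMGap.YM3IR

open CarrierBridge

/-! ## §1  The hypothesis-free ceiling: Wilson `β_W = 5/8` (tree `5/24`) on `ClusterDomainFR (1/250) (1/500) r` -/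

/-- **`SU(3)` lattice YM₃ mass gap on Bałaban's coupling set, receiving at Wilson `β_W = 5/8`, Y2's input HYPOTHESIS-FREE (PROVED
bookkeeping).**  engine-2's PV2T-star row `RobustBall.su3_clusterDomainClustering_dim3_pv2tStar_fiveEighths r` BY NAME (tree ceiling
`5/24`, ball `ClusterDomainFR (1/250) (1/500) r`, some rate `m > 0`).  EXACTLY ONE hypothesis is neither in print nor certified:
`IRConjecture3` (label of record R196: with existential `(C_b, κ)` a typed interface — a dictionary, not a reduction).
[cite: Balaban1985UV3, Thm 1 p.257; Thm 2 p.272] -/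
theorem massGap3Cofinal_su3_balaban_pv2tStar_fiveEighths_of_irConjecture3 {L : ℕ} {mk : Construction L} {eps0 : ℝ → ℝ}
    (hfam : Nonempty (Family L eps0)) (r : ℕ) {C_b κ : ℝ} (hC : 0 < C_b) (hκ : 0 < κ) (hUV : BalabanUV3 mk)
    (hIR : IRConjecture3 (ballOfRobustBallFR 3 (1 / 250) (1 / 500) r (5 / 24)) suFrobDist (fundamentalRep (Fin 3))
      (balabanCouplings L (suGroupModel 3) eps0) C_b κ) :
    MassGap3Cofinal (balabanCouplings L (suGroupModel 3) eps0) suFrobDist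
      (fundamentalRep (Fin 3) : RobustBall.SUN 3 →* Matrix (Fin 3) (Fin 3) ℂ) := by
  obtain ⟨m, hm, hRB, -⟩ := RobustBall.su3_clusterDomainClustering_dim3_pv2tStar_fiveEighths r
  exact massGap3Cofinal_suN_balaban_of_irConjecture3 hfam hC hκ hm hUV hRB hIR

/-- **In PRINT'S quantifier order at `β_W = 5/8` (PROVED bookkeeping):** `∃ eps0` first (print, p. 256 L15–18), then for every `r`,
`C_b`, `κ`: `IRConjecture3` on the row's ball (label of record R196: a dictionary, not a reduction) ⟹ `MassGap3Cofinal`.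
[cite: Balaban1985UV3, p.256 L15–18; Thm 2 p.272] -/
theorem massGap3Cofinal_su3_balaban_pv2tStar_fiveEighths_printedOrder_of_irConjecture3 {L : ℕ} (mk : Construction L)
    (hUV : BalabanUV3 mk) :
    ∃ eps0 : ℝ → ℝ, (∀ g : ℝ, 0 < g → 0 < eps0 g) ∧
      (∀ S : Family L eps0, ∀ k, k ≤ S.1.K → (mk (RobustBall.SUN 3) (suGroupModel 3) S.1).ineq41_47 k) ∧
      ∀ (r : ℕ) (C_b κ : ℝ), 0 < C_b → 0 < κ → Nonempty (Family L eps0) →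
        IRConjecture3 (ballOfRobustBallFR 3 (1 / 250) (1 / 500) r (5 / 24)) suFrobDist (fundamentalRep (Fin 3))
          (balabanCouplings L (suGroupModel 3) eps0) C_b κ →
          MassGap3Cofinal (balabanCouplings L (suGroupModel 3) eps0) suFrobDist
            (fundamentalRep (Fin 3) : RobustBall.SUN 3 →* Matrix (Fin 3) (Fin 3) ℂ) := by
  obtain ⟨eps0, hpos, h2, h⟩ := massGap3Cofinal_suN_balaban_printedOrder_of_irConjecture3 (N := 3) mk hUV
  refine ⟨eps0, hpos, h2, fun r C_b κ hC hκ hfam hIR => ?_⟩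
  obtain ⟨m, hm, hRB, -⟩ := RobustBall.su3_clusterDomainClustering_dim3_pv2tStar_fiveEighths r
  exact h (ballOfRobustBallFR 3 (1 / 250) (1 / 500) r (5 / 24)) C_b κ m hC hκ hm hfam hRB hIR

/-! ## §2  Wilson `β_W = 3/5` (tree `1/5`) on `ClusterDomainFR (1/25) (1/50) r` and `β_W = 11/20` (tree `11/60`) on
`ClusterDomainFR (57/500) (57/1000) r` -/

/-- **The same at Wilson `β_W = 3/5` (tree ceiling `1/5`), Y2's input HYPOTHESIS-FREE (PROVED bookkeeping):** engine-2's
`RobustBall.su3_clusterDomainClustering_dim3_pv2tStar_threeFifths r` (ball `ClusterDomainFR (1/25) (1/50) r` — the radii of engine-2's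
`ℤ³` segment `su3_massGapOnBallZdG_dim3_pv2tStar_upTo_threeFifths`); the ONE non-printed, non-certified hypothesis is `IRConjecture3`
(label of record R196: with existential `(C_b, κ)` a dictionary, not a reduction). [cite: Balaban1985UV3, Thm 1 p.257; Thm 2 p.272] -/
theorem massGap3Cofinal_su3_balaban_pv2tStar_threeFifths_of_irConjecture3 {L : ℕ} {mk : Construction L} {eps0 : ℝ → ℝ}
    (hfam : Nonempty (Family L eps0)) (r : ℕ) {C_b κ : ℝ} (hC : 0 < C_b) (hκ : 0 < κ) (hUV : BalabanUV3 mk)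
    (hIR : IRConjecture3 (ballOfRobustBallFR 3 (1 / 25) (1 / 50) r (1 / 5)) suFrobDist (fundamentalRep (Fin 3))
      (balabanCouplings L (suGroupModel 3) eps0) C_b κ) :
    MassGap3Cofinal (balabanCouplings L (suGroupModel 3) eps0) suFrobDist
      (fundamentalRep (Fin 3) : RobustBall.SUN 3 →* Matrix (Fin 3) (Fin 3) ℂ) := by
  obtain ⟨m, hm, hRB, -⟩ := RobustBall.su3_clusterDomainClustering_dim3_pv2tStar_threeFifths r
  exact massGap3Cofinal_suN_balaban_of_irConjecture3 hfam hC hκ hm hUV hRB hIR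

/-- **The same at Wilson `β_W = 11/20` (tree ceiling `11/60`), Y2's input HYPOTHESIS-FREE (PROVED bookkeeping):** engine-2's
`RobustBall.su3_clusterDomainClustering_dim3_pv2tStar_elevenTwentieths r` (ball `ClusterDomainFR (57/500) (57/1000) r`); the ONE
non-printed, non-certified hypothesis is `IRConjecture3` (label of record R196: a dictionary, not a reduction).
[cite: Balaban1985UV3, Thm 1 p.257; Thm 2 p.272] -/
theorem massGap3Cofinal_su3_balaban_pv2tStar_elevenTwentieths_of_irConjecture3 {L : ℕ} {mk : Construction L} {eps0 : ℝ → ℝ}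
    (hfam : Nonempty (Family L eps0)) (r : ℕ) {C_b κ : ℝ} (hC : 0 < C_b) (hκ : 0 < κ) (hUV : BalabanUV3 mk)
    (hIR : IRConjecture3 (ballOfRobustBallFR 3 (57 / 500) (57 / 1000) r (11 / 60)) suFrobDist (fundamentalRep (Fin 3))
      (balabanCouplings L (suGroupModel 3) eps0) C_b κ) :
    MassGap3Cofinal (balabanCouplings L (suGroupModel 3) eps0) suFrobDist
      (fundamentalRep (Fin 3) : RobustBall.SUN 3 →* Matrix (Fin 3) (Fin 3) ℂ) := by
  obtain ⟨m, hm, hRB, -⟩ := RobustBall.su3_clusterDomainClustering_dim3_pv2tStar_elevenTwentieths r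
  exact massGap3Cofinal_suN_balaban_of_irConjecture3 hfam hC hκ hm hUV hRB hIR

/-! ## §3  The FAT rows at the `BalabanCeilingsSU3PV2` ceilings: Wilson `13/25` on `ClusterDomainFR (39/250) (39/500) r` and
Wilson `1/2` on `ClusterDomainFR (23/125) (23/250) r` (larger ball ⇒ weaker hypothesis (a) ⇒ stronger sentence, `BallMonotone`) -/

/-- **The §Y4 sentence at Wilson `β_W = 13/25` (tree `13/75`) on the FAT PV2T ball `ClusterDomainFR (39/250) (39/500) r`** — a strictly
larger receiving ball than `BalabanCeilingsSU3PV2`'s `(3/125, 3/250)` at the same ceiling, hence a WEAKER hypothesis (a)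
(`YM3IR/BallMonotone.lean`, `irConjecture3_mono` with `inBall_ballOfRobustBallFR_mono`); engine-2's
`RobustBall.su3_clusterDomainClustering_dim3_pv2tStar_thirteenTwentyFifths r` BY NAME (PROVED bookkeeping; label of record R196:
`IRConjecture3` with existential `(C_b, κ)` is a dictionary, not a reduction). [cite: Balaban1985UV3, Thm 1 p.257; Thm 2 p.272] -/
theorem massGap3Cofinal_su3_balaban_pv2tStar_thirteenTwentyFifths_of_irConjecture3 {L : ℕ} {mk : Construction L} {eps0 : ℝ → ℝ}
    (hfam : Nonempty (Family L eps0)) (r : ℕ) {C_b κ : ℝ} (hC : 0 < C_b) (hκ : 0 < κ) (hUV : BalabanUV3 mk)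
    (hIR : IRConjecture3 (ballOfRobustBallFR 3 (39 / 250) (39 / 500) r (13 / 75)) suFrobDist (fundamentalRep (Fin 3))
      (balabanCouplings L (suGroupModel 3) eps0) C_b κ) :
    MassGap3Cofinal (balabanCouplings L (suGroupModel 3) eps0) suFrobDist
      (fundamentalRep (Fin 3) : RobustBall.SUN 3 →* Matrix (Fin 3) (Fin 3) ℂ) := by
  obtain ⟨m, hm, hRB, -⟩ := RobustBall.su3_clusterDomainClustering_dim3_pv2tStar_thirteenTwentyFifths r
  exact massGap3Cofinal_suN_balaban_of_irConjecture3 hfam hC hκ hm hUV hRB hIR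

/-- **The §Y4 sentence at Wilson `β_W = 1/2` (tree `1/6`) on the FAT PV2T working ball `ClusterDomainFR (23/125) (23/250) r`** — strictly
larger than `BalabanCeilingsSU3PV2`'s `(3/50, 3/100)` at the same ceiling (weaker hypothesis (a), `BallMonotone`); engine-2's
`RobustBall.su3_clusterDomainClustering_dim3_pv2tStar_oneHalf r` BY NAME (PROVED bookkeeping; label of record R196 as above).
[cite: Balaban1985UV3, Thm 1 p.257; Thm 2 p.272] -/
theorem massGap3Cofinal_su3_balaban_pv2tStar_oneHalf_of_irConjecture3 {L : ℕ} {mk : Construction L} {eps0 : ℝ → ℝ}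
    (hfam : Nonempty (Family L eps0)) (r : ℕ) {C_b κ : ℝ} (hC : 0 < C_b) (hκ : 0 < κ) (hUV : BalabanUV3 mk)
    (hIR : IRConjecture3 (ballOfRobustBallFR 3 (23 / 125) (23 / 250) r (1 / 6)) suFrobDist (fundamentalRep (Fin 3))
      (balabanCouplings L (suGroupModel 3) eps0) C_b κ) :
    MassGap3Cofinal (balabanCouplings L (suGroupModel 3) eps0) suFrobDist
      (fundamentalRep (Fin 3) : RobustBall.SUN 3 →* Matrix (Fin 3) (Fin 3) ℂ) := by
  obtain ⟨m, hm, hRB, -⟩ := RobustBall.su3_clusterDomainClustering_dim3_pv2tStar_oneHalf r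
  exact massGap3Cofinal_suN_balaban_of_irConjecture3 hfam hC hκ hm hUV hRB hIR

/-! ## §4  The counted crossovers at the new ceilings (PROVED arithmetic) -/

/-- **`SU(3)` at the hypothesis-free ceiling `β⋆ = 5/24` (`β_W = 5/8`; PROVED arithmetic):** a member's coupling after `K + M'` steps is
below `5/24` iff `L^{M'} ≥ 8/(5γ₀²)`. [cite: Balaban1985UV3, (5) p.256] -/
theorem su3_betaTree_div_pow_le_5_24_iff {L : ℕ} (S : Scales L) (M' : ℕ) :
    betaTree (suGroupModel 3) S / (L : ℝ) ^ (S.K + M') ≤ 5 / 24 ↔ 8 / (5 * Dictionary.gammaSq S) ≤ (L : ℝ) ^ M' := by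
  rw [suN_betaTree_div_pow_le_iff S M' (by norm_num : (0 : ℝ) < 5 / 24)]
  have e : (((3 : ℕ) : ℝ) * Dictionary.gammaSq S * (5 / 24))⁻¹ = 8 / (5 * Dictionary.gammaSq S) := by
    have e1 : ((3 : ℕ) : ℝ) * Dictionary.gammaSq S * (5 / 24) = 5 * Dictionary.gammaSq S / 8 := by
      push_cast
      ring
    rw [e1, inv_div]
  rw [e]

/-- Hence at `β⋆ = 5/24` for `SU(3)` (PROVED arithmetic; `γ₀² ≤ 1`): in the window after `K + M'` steps forces `8/5 ≤ L^{M'}`, in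
particular `M' ≥ 1`. [cite: Balaban1985UV3, (5) p.256] -/
theorem su3_eightFifths_le_pow_of_betaTree_div_pow_le_5_24 {L : ℕ} (S : Scales L) (M' : ℕ)
    (h : betaTree (suGroupModel 3) S / (L : ℝ) ^ (S.K + M') ≤ 5 / 24) : (8 / 5 : ℝ) ≤ (L : ℝ) ^ M' := by
  have hγ : 0 < Dictionary.gammaSq S := Dictionary.gammaSq_pos S
  have hγ1 : Dictionary.gammaSq S ≤ 1 := Dictionary.gammaSq_le_one S
  have h3 : 8 / (5 * Dictionary.gammaSq S) ≤ (L : ℝ) ^ M' := (su3_betaTree_div_pow_le_5_24_iff S M').1 h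
  have h33 : (8 / 5 : ℝ) ≤ 8 / (5 * Dictionary.gammaSq S) := by
    rw [le_div_iff₀ (by positivity)]
    nlinarith
  exact h33.trans h3

/-- **The conjecture's counted task on the `SU(3)` `β_W = 5/8` row (PROVED arithmetic), at the row's ball for the record: `8/5 ≤ L^{M'}`.**
[cite: Balaban1985UV3, (5) p.256] -/
theorem su3_row_pv2tStar_fiveEighths_crossover_steps {L : ℕ} (S : Scales L) (M' : ℕ)
    (h : betaTree (suGroupModel 3) S / (L : ℝ) ^ (S.K + M') ≤
      (ballOfRobustBallFR 3 (1 / 250) (1 / 500) 0 (5 / 24)).βstar) :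
    (8 / 5 : ℝ) ≤ (L : ℝ) ^ M' :=
  su3_eightFifths_le_pow_of_betaTree_div_pow_le_5_24 S M' h

/-- **Hence at least ONE block-RG step beyond Bałaban's `K` at `O(1)` effective coupling (`M' ≠ 0`) on the hypothesis-free `SU(3)`
`5/8` row, for every admissible `γ₀` (PROVED arithmetic).** [cite: Balaban1985UV3, (5) p.256] -/
theorem su3_row_pv2tStar_fiveEighths_crossover_pos {L : ℕ} (S : Scales L) (M' : ℕ)
    (h : betaTree (suGroupModel 3) S / (L : ℝ) ^ (S.K + M') ≤
      (ballOfRobustBallFR 3 (1 / 250) (1 / 500) 0 (5 / 24)).βstar) :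
    M' ≠ 0 := by
  have h2 : (8 / 5 : ℝ) ≤ (L : ℝ) ^ M' := su3_row_pv2tStar_fiveEighths_crossover_steps S M' h
  rintro rfl
  norm_num at h2

/-- **`SU(3)` at `β⋆ = 1/5` (`β_W = 3/5`; PROVED arithmetic):** below `1/5` after `K + M'` steps iff `L^{M'} ≥ 5/(3γ₀²)`.
[cite: Balaban1985UV3, (5) p.256] -/
theorem su3_betaTree_div_pow_le_fifth_iff {L : ℕ} (S : Scales L) (M' : ℕ) :
    betaTree (suGroupModel 3) S / (L : ℝ) ^ (S.K + M') ≤ 1 / 5 ↔ 5 / (3 * Dictionary.gammaSq S) ≤ (L : ℝ) ^ M' := by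
  rw [suN_betaTree_div_pow_le_iff S M' (by norm_num : (0 : ℝ) < 1 / 5)]
  have e : (((3 : ℕ) : ℝ) * Dictionary.gammaSq S * (1 / 5))⁻¹ = 5 / (3 * Dictionary.gammaSq S) := by
    have e1 : ((3 : ℕ) : ℝ) * Dictionary.gammaSq S * (1 / 5) = 3 * Dictionary.gammaSq S / 5 := by
      push_cast
      ring
    rw [e1, inv_div]
  rw [e]

/-- Hence at `β⋆ = 1/5` for `SU(3)` (PROVED arithmetic; `γ₀² ≤ 1`): in the window after `K + M'` steps forces `5/3 ≤ L^{M'}`, in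
particular `M' ≥ 1` (the same count serves the tier-2 `β_W = 3/5` row of `YM3IR/BalabanCeilingsSU3PV2TW.lean`, which cites it and does
not restate it). [cite: Balaban1985UV3, (5) p.256] -/
theorem su3_fiveThirds_le_pow_of_betaTree_div_pow_le_fifth {L : ℕ} (S : Scales L) (M' : ℕ)
    (h : betaTree (suGroupModel 3) S / (L : ℝ) ^ (S.K + M') ≤ 1 / 5) : (5 / 3 : ℝ) ≤ (L : ℝ) ^ M' := by
  have hγ : 0 < Dictionary.gammaSq S := Dictionary.gammaSq_pos S
  have hγ1 : Dictionary.gammaSq S ≤ 1 := Dictionary.gammaSq_le_one S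
  have h3 : 5 / (3 * Dictionary.gammaSq S) ≤ (L : ℝ) ^ M' := (su3_betaTree_div_pow_le_fifth_iff S M').1 h
  have h33 : (5 / 3 : ℝ) ≤ 5 / (3 * Dictionary.gammaSq S) := by
    rw [le_div_iff₀ (by positivity)]
    nlinarith
  exact h33.trans h3

/-- **`SU(3)` at `β⋆ = 11/60` (`β_W = 11/20`; PROVED arithmetic):** below `11/60` after `K + M'` steps iff `L^{M'} ≥ 20/(11γ₀²)`.
[cite: Balaban1985UV3, (5) p.256] -/
theorem su3_betaTree_div_pow_le_11_60_iff {L : ℕ} (S : Scales L) (M' : ℕ) :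
    betaTree (suGroupModel 3) S / (L : ℝ) ^ (S.K + M') ≤ 11 / 60 ↔ 20 / (11 * Dictionary.gammaSq S) ≤ (L : ℝ) ^ M' := by
  rw [suN_betaTree_div_pow_le_iff S M' (by norm_num : (0 : ℝ) < 11 / 60)]
  have e : (((3 : ℕ) : ℝ) * Dictionary.gammaSq S * (11 / 60))⁻¹ = 20 / (11 * Dictionary.gammaSq S) := by
    have e1 : ((3 : ℕ) : ℝ) * Dictionary.gammaSq S * (11 / 60) = 11 * Dictionary.gammaSq S / 20 := by
      push_cast
      ring
    rw [e1, inv_div]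
  rw [e]

end Summit.Ventures.YMGap.YM3IR

end
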